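import Summits.QuantumFields.YangMills.Theorems.AlphaInputsT3ACv3WindowIneq
import Summits.QuantumFields.YangMills.Theorems.AlphaInputsT3ACv3DataSchemaRec
import HarnessLib

/-!
# `AlphaInputsT3ACv3DataPartsRec` — STRATEGY B for 2′: the registered 2′ text `AlphaInputsT3ACv3Rec L` FROM THE DATA PARTS ALONE — the record-parametric
# display with the constants row (N1) replaced by the decidable `C68`-inequality of `AlphaInputsT3ACv3WindowIneq` (attainable at every profile by
# `AlphaInputsT3ACv3ProfileRecord.exists_alphaConsts_profile`) — lane `pub-balaban3d`, seat alpha-2 (g0)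

WHAT.  `DataPartsT3ACRec L` (hypothesis schema, OPEN): `AlphaInputsT3ACv3Rec L`'s shell `∃ b₁ p₁ ∀ b₀ p₀ ⪰ ∃ 𝔠 a₀ a₁, 𝔠.b₀ = b₀ ∧ 𝔠.p₀ = p₀ ∧ consts ∧ …` whose body is:
the STRUCTURAL inequality `2L²·avgWindowFactor(L)·L^{−1/2}(1 + ½log L)^{p₀} ≤ C68` on the record, and, for every family of block size `L`, the two DATA clauses of
`DataSchemaT3AC` — (D6) non-emptiness of the adapted classes and «(D5) trivial-history minimiser rows ∧ (D1)–(D4),(D7) cluster-expansion data rows for every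
adapted minimiser data».  ★ `alphaInputsT3ACv3Rec_of_dataParts : DataPartsT3ACRec L → AlphaInputsT3ACv3Rec L` (`ofV3At_of_parts` per family).
HONEST FRAMING: 2′ = «displayed DATA (for the constructed argmin) + [7] Thm 1 at the trivial history + non-emptiness of the adapted class», at a record the data
provider names (its O(1) constants are the expansion's); nothing of the cluster expansion is proved; nothing about d = 4, the continuum, or a mass gap.

References: T. Bałaban, Commun. Math. Phys. 102 (1985) 255–275 [Balaban1985UV3] ((7) p.257, Thm 2 p.272); CMP 102 (1985) 277–309 [Balaban1985Variational]
(Thm 1 (8) p.279).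
-/

set_option autoImplicit false

noncomputable section

namespace Summit.QuantumFields.YangMills.Theorems

open Literature.MathematicalPhysics.QuantumFieldTheory.Balaban1983to89
open Literature.MathematicalPhysics.QuantumFieldTheory.Balaban1983to89.T3ContinuumYM3Torus
open Literature.MathematicalPhysics.QuantumFieldTheory.Balaban1985CMP102.Setting
open Summit.QuantumFields.Balaban3D.Carriers
open Summit.QuantumFields.Balaban3D.Proofs.Primitives

/-- **`DataPartsT3ACRec L` — THE RECORD-PARAMETRIC DATA PARTS** (hypothesis schema, OPEN, never asserted): thresholds `b₁, p₁` such that for every profile beyond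
them there is a primitive-constants record `𝔠` with EXACTLY that p-function, [7] constants `a₀, a₁`, the STRUCTURAL `C68`-inequality of the window row (N1), and, for
every three-torus family of block size `L`, every coupling of the window and every run: (D6) the adapted classes are non-empty, and there is a trivial-history
minimiser family with (D5) and the cluster-expansion data rows (D1)–(D4), (D7) for every adapted minimiser data.
[cite: Balaban1985UV3, (7) p.257 and Thm 2 p.272; Balaban1985Variational, Thm 1 (8) p.279] -/
def DataPartsT3ACRec (L : ℕ) : Prop :=
  ∃ (b₁ p₁ : ℝ), ∀ (b₀ p₀ : ℝ), b₁ ≤ b₀ → p₁ ≤ p₀ →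
    ∃ (𝔠 : AlphaConsts L (suGroupModel 2).N) (a₀ a₁ : ℝ), 𝔠.b₀ = b₀ ∧ 𝔠.p₀ = p₀ ∧ 0 < a₀ ∧ 0 < a₁ ∧ 𝔠.B₃ * a₁ ≤ a₀ ∧
      2 * (L : ℝ) ^ 2 * avgWindowFactor L * (Real.sqrt ((L : ℝ)⁻¹) * (1 + Real.log (L : ℝ) / 2) ^ 𝔠.p₀) ≤ 𝔠.C68 ∧
      ∀ (F : T3Family) (hF : F.L = L),
        (∀ (γ : ℝ) (hγ : 0 < γ) (hγ1 : γ ≤ (min (hF ▸ 𝔠).gamma0 1) ^ 2) (K : ℕ),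
          AlphaInputsT3AC.AdaptedClassNonemptyT3 F (hF ▸ 𝔠) γ hγ hγ1 K) ∧
        (∀ (γ : ℝ) (hγ : 0 < γ) (hγ1 : γ ≤ (min (hF ▸ 𝔠).gamma0 1) ^ 2) (K : ℕ),
          ∃ Ut : (k : ℕ) → GaugeField (F.P K) k (Matrix.specialUnitaryGroup (Fin 2) ℂ) → GaugeField (F.P K) 0 (Matrix.specialUnitaryGroup (Fin 2) ℂ),
            AlphaInputsT3AC.TrivMinimiserRowsT3 F (hF ▸ 𝔠) γ hγ hγ1 a₀ a₁ K Ut ∧ AlphaInputsT3AC.DataRowsT3 F (hF ▸ 𝔠) γ hγ hγ1 K Ut)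

/-- At a family of block size `L`, the structural inequality of the record transports along `hF ▸`. [folklore] -/
theorem AlphaInputsT3AC.windowBound_cast {L : ℕ} {𝔠 : AlphaConsts L (suGroupModel 2).N}
    (hC : 2 * (L : ℝ) ^ 2 * avgWindowFactor L * (Real.sqrt ((L : ℝ)⁻¹) * (1 + Real.log (L : ℝ) / 2) ^ 𝔠.p₀) ≤ 𝔠.C68)
    (F : T3Family) (hF : F.L = L) :
    2 * (F.L : ℝ) ^ 2 * avgWindowFactor F.L * (Real.sqrt ((F.L : ℝ)⁻¹) * (1 + Real.log (F.L : ℝ) / 2) ^ (hF ▸ 𝔠).p₀) ≤ (hF ▸ 𝔠).C68 := by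
  subst hF
  exact hC

/-- **★ 2′ FROM THE DATA PARTS**: `DataPartsT3ACRec L → AlphaInputsT3ACv3Rec L` (`AlphaInputsT3AC.ofV3At_of_parts` at every family; (N1) discharged by the
structural inequality). [cite: Balaban1985UV3, Thm 2 p.272; Balaban1985Variational, Thm 1 (8) p.279] -/
theorem alphaInputsT3ACv3Rec_of_dataParts {L : ℕ} (h : DataPartsT3ACRec L) : AlphaInputsT3ACv3Rec L := by
  obtain ⟨b₁, p₁, h⟩ := h
  refine ⟨b₁, p₁, fun b₀ p₀ hb hp => ?_⟩
  obtain ⟨𝔠, a₀, a₁, h1, h2, h3, h4, h5, hC, hD⟩ := h b₀ p₀ hb hp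
  refine ⟨𝔠, a₀, a₁, h1, h2, h3, h4, h5, fun F hF => ?_⟩
  exact AlphaInputsT3AC.ofV3At_of_parts (AlphaInputsT3AC.windowBound_cast hC F hF) (hD F hF).1 (hD F hF).2

/-- The data-parts display implies the full record-parametric schema `DataSchemaT3ACRec L` (the (N1) row supplied by the structural inequality).
[cite: Balaban1985UV3, Thm 2 p.272] -/
theorem dataSchemaT3ACRec_of_dataParts {L : ℕ} (h : DataPartsT3ACRec L) : DataSchemaT3ACRec L := by
  obtain ⟨b₁, p₁, h⟩ := h
  refine ⟨b₁, p₁, fun b₀ p₀ hb hp => ?_⟩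
  obtain ⟨𝔠, a₀, a₁, h1, h2, h3, h4, h5, hC, hD⟩ := h b₀ p₀ hb hp
  refine ⟨𝔠, a₀, a₁, h1, h2, h3, h4, h5, fun F hF => ?_⟩
  exact AlphaInputsT3AC.dataSchemaT3AC_of_parts (AlphaInputsT3AC.windowBound_cast hC F hF) (hD F hF).1 (hD F hF).2

end Summit.QuantumFields.YangMills.Theorems

end
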